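import Mathlib
import Summits.NavierStokesRegularity.FluidComputer.AbcClassIIBasesPrep

/-!
# GROUP-B END-TO-END ON THE MODEL, CLASS II — ARBITRARY ORBIT BASES (prep 2): transfer of a coordinate
# eigenvector of `[−(|O|²/R)δ + am]` back to the existential basis
(profile-cert-3 g7, cell `ns-blowup`, 2026-08-27)

HONEST FRAMING (human rulings D-0035/D-0074): nothing here is a claim about Navier–Stokes blow-up.
WHAT THIS IS NOT: not NS evidence. MODEL lane (NS linearised about the forced ABC flow `abcFlow 1 1 1`,
class II); no certificate, number or census word moves. Sequel of instab4 g7's `AbcClassIIBasesPrep`.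
**`coord_transfer`**: for ANY family `e O` of real orthonormal bases of the class-II orbit spaces (basis
families `bf`, first-order matrix `am`), a coordinate vector `w'` solving
`−(|O_i|²/R) w'_i + Σ_{j ∈ nbrIdx i} am_ij w'_j = λ w'_i` for every `i` gives `w ⟨O,a⟩ := Σ_b M_O a b · w'⟨O,b⟩`
(`M_O` the orthogonal change-of-basis matrix of `AbcClassIIBasesPrep.coef_eq`) solving the same
equation for instab4's `amat` (row orthogonality + `am = Mᵀ amat M` orbitwise + a swap of the two inner
indices on the saturated band `nbrIdx`), with EQUAL weighted square sums on every cube (column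
orthogonality) and `w ≠ 0` if `w' ≠ 0` — i.e. exactly the input of instab4's synthesis
`AbcClassIISynthesis.certifier_eigen_of_coordinates` / `rapidDecay_of_coordinates`. Mathlib + the file
named; no new definitions. bears_on LADDER-NS N5 / Z4-a(1). [folklore].
-/

noncomputable section

open scoped BigOperators ComplexConjugate InnerProductSpace Matrix
open Finset Matrix

namespace Summit.NavierStokesRegularity.FluidComputer.AbcClassIIEigenpair

open Literature.Analysis.FunctionSpaces Literature.Analysis.FunctionSpaces.Torus
open Literature.Analysis.FunctionSpaces.EuclideanSpace
open Literature.Analysis.FluidPDE Literature.Analysis.FluidPDE.SteadyLattice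
open Summit.NavierStokesRegularity.FluidComputer.AbcClassII

section BasesTransfer

variable (e : ∀ O : Orbit, OrthonormalBasis (Fin (odim O)) ℝ (realSpace O.1))
variable (bf : Idx → Fam)
variable (hbf : ∀ i : Idx, bf i = extend i.1.1 ((e i.1 i.2 : realSpace i.1.1) : EuclideanSpace ℂ (↥i.1.1 × Fin 3)))
variable (am : Idx → Idx → ℝ)
variable (ham : ∀ i j : Idx, am i j =
  (∑ k ∈ i.1.1, (inner ℂ (bf i k) (Torus.lerayCoeff k (crossForm 1 1 1 (bf j) k)) : ℂ)).re)

section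
include hbf ham

/-- **Coordinate transfer.** If `w'` solves `−(|O_i|²/R) w'_i + Σ_{j ∈ nbrIdx i} am_ij w'_j = λ w'_i` for
every `i`, then `w ⟨O, a⟩ := Σ_b M_O a b · w' ⟨O, b⟩` (`M_O` the orthogonal change-of-basis matrix) solves
the same equation for `amat`; on every cube the weighted square sums of `w` and `w'` agree; and
`w ≠ 0` if `w' ≠ 0`. -/
theorem coord_transfer {R : ℝ} (lam : ℂ) (w' : Idx → ℂ)
    (hE : ∀ i : Idx, ((-(onormSq i.1 / R) : ℝ) : ℂ) * w' i +
      ∑ j ∈ nbrIdx i, ((am i j : ℝ) : ℂ) * w' j = lam * w' i) :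
    ∃ w : Idx → ℂ,
      (∀ i : Idx, ((-(onormSq i.1 / R) : ℝ) : ℂ) * w i +
        ∑ j ∈ nbrIdx i, ((amat i j : ℝ) : ℂ) * w j = lam * w i) ∧
      (∀ (n : ℕ) (g : Orbit → ℝ), ∑ i ∈ cubeIdx n, g i.1 * ‖w i‖ ^ 2 =
        ∑ i ∈ cubeIdx n, g i.1 * ‖w' i‖ ^ 2) ∧
      (w' ≠ 0 → w ≠ 0) := by
  classical
  set w : Idx → ℂ := fun i => ∑ b : Fin (odim i.1),
    ((((orbitBasis i.1).toBasis.toMatrix (e i.1)) i.2 b : ℝ) : ℂ) * w' ⟨i.1, b⟩ with hw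
  have hwO : ∀ (O : Orbit) (a : Fin (odim O)), w ⟨O, a⟩ = ∑ b : Fin (odim O),
      ((((orbitBasis O).toBasis.toMatrix (e O)) a b : ℝ) : ℂ) * w' ⟨O, b⟩ := fun O a => rfl
  -- orthogonality relations, complexified
  have hrows : ∀ (O : Orbit) (a a' : Fin (odim O)), ∑ b : Fin (odim O),
      ((((orbitBasis O).toBasis.toMatrix (e O)) a b : ℝ) : ℂ) *
        ((((orbitBasis O).toBasis.toMatrix (e O)) a' b : ℝ) : ℂ) = if a = a' then 1 else 0 := by
    intro O a a'
    have h := coefM_orth_rows e O a a'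
    have h' := congrArg (fun r : ℝ => (r : ℂ)) h
    push_cast at h'
    rw [h']
    split_ifs <;> simp
  have hcols : ∀ (O : Orbit) (b b' : Fin (odim O)), ∑ a : Fin (odim O),
      ((((orbitBasis O).toBasis.toMatrix (e O)) a b : ℝ) : ℂ) *
        ((((orbitBasis O).toBasis.toMatrix (e O)) a b' : ℝ) : ℂ) = if b = b' then 1 else 0 := by
    intro O b b'
    have h := coefM_orth_cols e O b b'
    have h' := congrArg (fun r : ℝ => (r : ℂ)) h
    push_cast at h'
    rw [h']
    split_ifs <;> simp
  -- inverse transfer on one orbit: `Σ_a M a b · w ⟨O,a⟩ = w' ⟨O,b⟩`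
  have hinv : ∀ (O : Orbit) (b : Fin (odim O)), ∑ a : Fin (odim O),
      ((((orbitBasis O).toBasis.toMatrix (e O)) a b : ℝ) : ℂ) * w ⟨O, a⟩ = w' ⟨O, b⟩ := by
    intro O b
    calc ∑ a : Fin (odim O), ((((orbitBasis O).toBasis.toMatrix (e O)) a b : ℝ) : ℂ) * w ⟨O, a⟩
        = ∑ a : Fin (odim O), ∑ b' : Fin (odim O),
            ((((orbitBasis O).toBasis.toMatrix (e O)) a b : ℝ) : ℂ) *
              ((((orbitBasis O).toBasis.toMatrix (e O)) a b' : ℝ) : ℂ) * w' ⟨O, b'⟩ := by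
          refine Finset.sum_congr rfl fun a _ => ?_
          rw [hwO, Finset.mul_sum]
          exact Finset.sum_congr rfl fun b' _ => by ring
      _ = ∑ b' : Fin (odim O), (∑ a : Fin (odim O),
            ((((orbitBasis O).toBasis.toMatrix (e O)) a b : ℝ) : ℂ) *
              ((((orbitBasis O).toBasis.toMatrix (e O)) a b' : ℝ) : ℂ)) * w' ⟨O, b'⟩ := by
          rw [Finset.sum_comm]
          exact Finset.sum_congr rfl fun b' _ => by rw [Finset.sum_mul]
      _ = w' ⟨O, b⟩ := by
          rw [Finset.sum_eq_single b (fun b' _ hb' => by rw [hcols, if_neg (Ne.symm hb'), zero_mul])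
            (fun h => absurd (Finset.mem_univ b) h), hcols, if_pos rfl, one_mul]
  -- saturated index sets decompose orbitwise
  have hsigma : ∀ {T : Finset Idx}, (∀ i ∈ T, ∀ x : Fin (odim i.1), (⟨i.1, x⟩ : Idx) ∈ T) →
      ∀ Φ : (O : Orbit) → Fin (odim O) → Fin (odim O) → ℂ,
        ∑ j ∈ T, ∑ x : Fin (odim j.1), Φ j.1 x j.2 = ∑ j ∈ T, ∑ x : Fin (odim j.1), Φ j.1 j.2 x := by
    intro T hT Φ
    rw [← Finset.sum_sigma T (fun j : Idx => (Finset.univ : Finset (Fin (odim j.1))))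
        (fun p => Φ p.1.1 p.2 p.1.2),
      ← Finset.sum_sigma T (fun j : Idx => (Finset.univ : Finset (Fin (odim j.1))))
        (fun p => Φ p.1.1 p.1.2 p.2)]
    refine Finset.sum_bij' (fun p _ => ⟨(⟨p.1.1, p.2⟩ : Idx), p.1.2⟩)
      (fun p _ => ⟨(⟨p.1.1, p.2⟩ : Idx), p.1.2⟩) ?_ ?_ ?_ ?_ ?_
    · intro p hp
      exact Finset.mem_sigma.mpr ⟨hT p.1 (Finset.mem_sigma.mp hp).1 p.2, Finset.mem_univ _⟩
    · intro p hp
      exact Finset.mem_sigma.mpr ⟨hT p.1 (Finset.mem_sigma.mp hp).1 p.2, Finset.mem_univ _⟩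
    · intro p _; rfl
    · intro p _; rfl
    · intro p _; rfl
  have hnbr_sat : ∀ (i : Idx), ∀ j ∈ nbrIdx i, ∀ x : Fin (odim j.1), (⟨j.1, x⟩ : Idx) ∈ nbrIdx i :=
    fun i j hj x => (mem_nbrIdx (i := i) (j := (⟨j.1, x⟩ : Idx))).mpr ((mem_nbrIdx (i := i) (j := j)).mp hj)
  have hcube_sat : ∀ n : ℕ, ∀ j ∈ cubeIdx n, ∀ x : Fin (odim j.1), (⟨j.1, x⟩ : Idx) ∈ cubeIdx n :=
    fun n j hj x => cubeIdx_saturated n hj x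
  refine ⟨w, fun i => ?_, fun n g => ?_, fun hne h0 => hne ?_⟩
  · -- the eigen-equation at `i = ⟨O, a⟩`
    obtain ⟨O, a⟩ := i
    set M := (orbitBasis O).toBasis.toMatrix (e O) with hM
    -- (2) sum the `am`-equations of the orbit against the row `M a ·`
    have h2 : ((-(onormSq O / R) : ℝ) : ℂ) * w ⟨O, a⟩ +
        ∑ b : Fin (odim O), ((M a b : ℝ) : ℂ) *
          ∑ j ∈ nbrIdx (⟨O, a⟩ : Idx), ((am ⟨O, b⟩ j : ℝ) : ℂ) * w' j =
        lam * w ⟨O, a⟩ := by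
      have hb : ∀ b : Fin (odim O), ((M a b : ℝ) : ℂ) * (((-(onormSq O / R) : ℝ) : ℂ) * w' ⟨O, b⟩) +
          ((M a b : ℝ) : ℂ) * ∑ j ∈ nbrIdx (⟨O, a⟩ : Idx), ((am ⟨O, b⟩ j : ℝ) : ℂ) * w' j =
          ((M a b : ℝ) : ℂ) * (lam * w' ⟨O, b⟩) := fun b => by
        rw [← mul_add]; exact congrArg _ (hE ⟨O, b⟩)
      have hs := Finset.sum_congr rfl fun b (_ : b ∈ (Finset.univ : Finset (Fin (odim O)))) => hb b
      rw [Finset.sum_add_distrib] at hs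
      rw [hwO, Finset.mul_sum, Finset.mul_sum]
      calc ∑ b, ((-(onormSq O / R) : ℝ) : ℂ) * (((M a b : ℝ) : ℂ) * w' ⟨O, b⟩) +
            ∑ b, ((M a b : ℝ) : ℂ) * ∑ j ∈ nbrIdx (⟨O, a⟩ : Idx), ((am ⟨O, b⟩ j : ℝ) : ℂ) * w' j
          = ∑ b, ((M a b : ℝ) : ℂ) * (((-(onormSq O / R) : ℝ) : ℂ) * w' ⟨O, b⟩) +
            ∑ b, ((M a b : ℝ) : ℂ) * ∑ j ∈ nbrIdx (⟨O, a⟩ : Idx), ((am ⟨O, b⟩ j : ℝ) : ℂ) * w' j := by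
            congr 1; exact Finset.sum_congr rfl fun b _ => by ring
        _ = ∑ b, ((M a b : ℝ) : ℂ) * (lam * w' ⟨O, b⟩) := hs
        _ = ∑ b, lam * (((M a b : ℝ) : ℂ) * w' ⟨O, b⟩) := Finset.sum_congr rfl fun b _ => by ring
    -- (3) the first-order sums agree
    have h3 : ∑ b : Fin (odim O), ((M a b : ℝ) : ℂ) *
          ∑ j ∈ nbrIdx (⟨O, a⟩ : Idx), ((am ⟨O, b⟩ j : ℝ) : ℂ) * w' j =
        ∑ j ∈ nbrIdx (⟨O, a⟩ : Idx), ((amat ⟨O, a⟩ j : ℝ) : ℂ) * w j := by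
      -- expand `am ⟨O,b⟩ j`
      have hexp : ∀ (b : Fin (odim O)) (j : Idx), ((am ⟨O, b⟩ j : ℝ) : ℂ) =
          ∑ a₁ : Fin (odim O), ∑ a' : Fin (odim j.1), ((M a₁ b : ℝ) : ℂ) *
            ((((orbitBasis j.1).toBasis.toMatrix (e j.1)) a' j.2 : ℝ) : ℂ) *
              ((amat ⟨O, a₁⟩ ⟨j.1, a'⟩ : ℝ) : ℂ) := by
        intro b j
        rw [ham, eamat_eq e bf hbf ⟨O, b⟩ j]
        push_cast
        rfl
      -- LHS: move the `b`-sum inside and use row orthogonality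
      have hL : ∑ b : Fin (odim O), ((M a b : ℝ) : ℂ) *
            ∑ j ∈ nbrIdx (⟨O, a⟩ : Idx), ((am ⟨O, b⟩ j : ℝ) : ℂ) * w' j =
          ∑ j ∈ nbrIdx (⟨O, a⟩ : Idx), ∑ a' : Fin (odim j.1),
            ((((orbitBasis j.1).toBasis.toMatrix (e j.1)) a' j.2 : ℝ) : ℂ) *
              ((amat ⟨O, a⟩ ⟨j.1, a'⟩ : ℝ) : ℂ) * w' j := by
        calc ∑ b : Fin (odim O), ((M a b : ℝ) : ℂ) *
              ∑ j ∈ nbrIdx (⟨O, a⟩ : Idx), ((am ⟨O, b⟩ j : ℝ) : ℂ) * w' j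
            = ∑ b : Fin (odim O), ∑ j ∈ nbrIdx (⟨O, a⟩ : Idx), ∑ a₁ : Fin (odim O), ∑ a' : Fin (odim j.1),
                ((M a b : ℝ) : ℂ) * ((M a₁ b : ℝ) : ℂ) *
                  (((((orbitBasis j.1).toBasis.toMatrix (e j.1)) a' j.2 : ℝ) : ℂ) *
                    ((amat ⟨O, a₁⟩ ⟨j.1, a'⟩ : ℝ) : ℂ) * w' j) := by
              refine Finset.sum_congr rfl fun b _ => ?_
              rw [Finset.mul_sum]
              refine Finset.sum_congr rfl fun j _ => ?_
              rw [hexp b j, Finset.sum_mul, Finset.mul_sum]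
              refine Finset.sum_congr rfl fun a₁ _ => ?_
              rw [Finset.sum_mul, Finset.mul_sum]
              exact Finset.sum_congr rfl fun a' _ => by ring
          _ = ∑ j ∈ nbrIdx (⟨O, a⟩ : Idx), ∑ a₁ : Fin (odim O), ∑ a' : Fin (odim j.1),
                (∑ b : Fin (odim O), ((M a b : ℝ) : ℂ) * ((M a₁ b : ℝ) : ℂ)) *
                  (((((orbitBasis j.1).toBasis.toMatrix (e j.1)) a' j.2 : ℝ) : ℂ) *
                    ((amat ⟨O, a₁⟩ ⟨j.1, a'⟩ : ℝ) : ℂ) * w' j) := by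
              rw [Finset.sum_comm]
              refine Finset.sum_congr rfl fun j _ => ?_
              rw [Finset.sum_comm]
              refine Finset.sum_congr rfl fun a₁ _ => ?_
              rw [Finset.sum_comm]
              refine Finset.sum_congr rfl fun a' _ => ?_
              rw [Finset.sum_mul]
          _ = ∑ j ∈ nbrIdx (⟨O, a⟩ : Idx), ∑ a' : Fin (odim j.1),
                ((((orbitBasis j.1).toBasis.toMatrix (e j.1)) a' j.2 : ℝ) : ℂ) *
                  ((amat ⟨O, a⟩ ⟨j.1, a'⟩ : ℝ) : ℂ) * w' j := by
              refine Finset.sum_congr rfl fun j _ => ?_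
              rw [Finset.sum_eq_single a (fun a₁ _ hne => by
                  rw [hrows, if_neg (Ne.symm hne)]; simp) (fun h => absurd (Finset.mem_univ a) h),
                hrows, if_pos rfl]
              exact Finset.sum_congr rfl fun a' _ => by ring
      -- swap the two inner indices on the saturated set `nbrIdx ⟨O, a⟩`
      have hS := hsigma (hnbr_sat ⟨O, a⟩) (fun O' x y =>
        ((amat ⟨O, a⟩ ⟨O', x⟩ : ℝ) : ℂ) * ((((orbitBasis O').toBasis.toMatrix (e O')) x y : ℝ) : ℂ) *
          w' ⟨O', y⟩)
      rw [hL]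
      calc ∑ j ∈ nbrIdx (⟨O, a⟩ : Idx), ∑ a' : Fin (odim j.1),
            ((((orbitBasis j.1).toBasis.toMatrix (e j.1)) a' j.2 : ℝ) : ℂ) *
              ((amat ⟨O, a⟩ ⟨j.1, a'⟩ : ℝ) : ℂ) * w' j
          = ∑ j ∈ nbrIdx (⟨O, a⟩ : Idx), ∑ x : Fin (odim j.1),
              ((amat ⟨O, a⟩ ⟨j.1, x⟩ : ℝ) : ℂ) *
                ((((orbitBasis j.1).toBasis.toMatrix (e j.1)) x j.2 : ℝ) : ℂ) * w' ⟨j.1, j.2⟩ := by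
            refine Finset.sum_congr rfl fun j _ => ?_
            obtain ⟨O', y⟩ := j
            exact Finset.sum_congr rfl fun x _ => by ring
        _ = ∑ j ∈ nbrIdx (⟨O, a⟩ : Idx), ∑ x : Fin (odim j.1),
              ((amat ⟨O, a⟩ ⟨j.1, j.2⟩ : ℝ) : ℂ) *
                ((((orbitBasis j.1).toBasis.toMatrix (e j.1)) j.2 x : ℝ) : ℂ) * w' ⟨j.1, x⟩ := hS
        _ = ∑ j ∈ nbrIdx (⟨O, a⟩ : Idx), ((amat ⟨O, a⟩ j : ℝ) : ℂ) * w j := by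
            refine Finset.sum_congr rfl fun j _ => ?_
            obtain ⟨O', y⟩ := j
            rw [hwO O' y, Finset.mul_sum]
            exact Finset.sum_congr rfl fun x _ => by ring
    have goal : ((-(onormSq O / R) : ℝ) : ℂ) * w ⟨O, a⟩ +
        ∑ j ∈ nbrIdx (⟨O, a⟩ : Idx), ((amat ⟨O, a⟩ j : ℝ) : ℂ) * w j = lam * w ⟨O, a⟩ := by
      rw [← h3]; exact h2
    exact goal
  · -- weighted square sums on cubes (complexify, expand, swap, collapse by column orthogonality)
    have hc : ((∑ i ∈ cubeIdx n, g i.1 * ‖w i‖ ^ 2 : ℝ) : ℂ) =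
        ((∑ i ∈ cubeIdx n, g i.1 * ‖w' i‖ ^ 2 : ℝ) : ℂ) := by
      push_cast
      have hsq : ∀ z : ℂ, ((‖z‖ : ℂ)) ^ 2 = conj z * z := fun z => by
        rw [mul_comm, Complex.mul_conj, Complex.normSq_eq_norm_sq]; push_cast; ring
      simp_rw [hsq]
      have hS := hsigma (hcube_sat n) (fun O b a => ((g O : ℝ) : ℂ) *
        ∑ b' : Fin (odim O), ((((orbitBasis O).toBasis.toMatrix (e O)) a b : ℝ) : ℂ) *
          ((((orbitBasis O).toBasis.toMatrix (e O)) a b' : ℝ) : ℂ) * (conj (w' ⟨O, b⟩) * w' ⟨O, b'⟩))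
      calc ∑ i ∈ cubeIdx n, ((g i.1 : ℝ) : ℂ) * (conj (w i) * w i)
          = ∑ i ∈ cubeIdx n, ∑ b : Fin (odim i.1), ((g i.1 : ℝ) : ℂ) *
              ∑ b' : Fin (odim i.1), ((((orbitBasis i.1).toBasis.toMatrix (e i.1)) i.2 b : ℝ) : ℂ) *
                ((((orbitBasis i.1).toBasis.toMatrix (e i.1)) i.2 b' : ℝ) : ℂ) *
                  (conj (w' ⟨i.1, b⟩) * w' ⟨i.1, b'⟩) := by
            refine Finset.sum_congr rfl fun i _ => ?_
            rw [← Finset.mul_sum]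
            congr 1
            rw [hwO i.1 i.2, map_sum, Finset.sum_mul]
            refine Finset.sum_congr rfl fun b _ => ?_
            rw [Finset.mul_sum]
            refine Finset.sum_congr rfl fun b' _ => ?_
            rw [map_mul, Complex.conj_ofReal]
            ring
        _ = ∑ i ∈ cubeIdx n, ∑ x : Fin (odim i.1), ((g i.1 : ℝ) : ℂ) *
              ∑ b' : Fin (odim i.1), ((((orbitBasis i.1).toBasis.toMatrix (e i.1)) x i.2 : ℝ) : ℂ) *
                ((((orbitBasis i.1).toBasis.toMatrix (e i.1)) x b' : ℝ) : ℂ) *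
                  (conj (w' ⟨i.1, i.2⟩) * w' ⟨i.1, b'⟩) := hS
        _ = ∑ i ∈ cubeIdx n, ((g i.1 : ℝ) : ℂ) * (conj (w' i) * w' i) := by
            refine Finset.sum_congr rfl fun i _ => ?_
            obtain ⟨O', y⟩ := i
            rw [← Finset.mul_sum]
            congr 1
            calc ∑ x : Fin (odim O'), ∑ b' : Fin (odim O'),
                  ((((orbitBasis O').toBasis.toMatrix (e O')) x y : ℝ) : ℂ) *
                    ((((orbitBasis O').toBasis.toMatrix (e O')) x b' : ℝ) : ℂ) *
                      (conj (w' ⟨O', y⟩) * w' ⟨O', b'⟩)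
                = ∑ b' : Fin (odim O'), (∑ x : Fin (odim O'),
                    ((((orbitBasis O').toBasis.toMatrix (e O')) x y : ℝ) : ℂ) *
                      ((((orbitBasis O').toBasis.toMatrix (e O')) x b' : ℝ) : ℂ)) *
                    (conj (w' ⟨O', y⟩) * w' ⟨O', b'⟩) := by
                  rw [Finset.sum_comm]
                  exact Finset.sum_congr rfl fun b' _ => by rw [Finset.sum_mul]
              _ = conj (w' ⟨O', y⟩) * w' ⟨O', y⟩ := by
                  rw [Finset.sum_eq_single y (fun b' _ hne => by
                      rw [hcols, if_neg (Ne.symm hne), zero_mul])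
                    (fun h => absurd (Finset.mem_univ _) h), hcols, if_pos rfl, one_mul]
    exact_mod_cast hc
  · -- non-vanishing: `w = 0 ⇒ w' = 0`
    funext j
    obtain ⟨O, b⟩ := j
    rw [← hinv O b]
    refine Finset.sum_eq_zero fun a _ => ?_
    rw [show w ⟨O, a⟩ = 0 from congrFun h0 ⟨O, a⟩, mul_zero]

end

end BasesTransfer

/-- **Summability transfers along equal cube sums**: if the weighted square sums of `wa` and `w` agree
on every cube `cubeIdx n` (non-negative weights) and `Σ_i g_i |w_i|²` converges, so does `Σ_i g_i |wa_i|²`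
(every finite index set lies in a cube). Used with `coord_transfer`. -/
theorem summable_of_cube_sums (g : Idx → ℝ) (hg : ∀ i, 0 ≤ g i) (w wa : Idx → ℂ)
    (hsums : ∀ n : ℕ, ∑ i ∈ cubeIdx n, g i * ‖wa i‖ ^ 2 = ∑ i ∈ cubeIdx n, g i * ‖w i‖ ^ 2)
    (hw : Summable fun i => g i * ‖w i‖ ^ 2) : Summable fun i => g i * ‖wa i‖ ^ 2 := by
  classical
  refine summable_of_sum_le (c := ∑' i, g i * ‖w i‖ ^ 2) (fun i => mul_nonneg (hg i) (sq_nonneg _))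
    (fun u => ?_)
  obtain ⟨n, hn⟩ : ∃ n, u ⊆ cubeIdx n :=
    ⟨u.sup fun i => osupNorm i.1, fun i hi =>
      mem_cubeIdx.mpr (Finset.le_sup (f := fun i : Idx => osupNorm i.1) hi)⟩
  calc ∑ i ∈ u, g i * ‖wa i‖ ^ 2 ≤ ∑ i ∈ cubeIdx n, g i * ‖wa i‖ ^ 2 :=
        Finset.sum_le_sum_of_subset_of_nonneg hn fun i _ _ => mul_nonneg (hg i) (sq_nonneg _)
    _ = ∑ i ∈ cubeIdx n, g i * ‖w i‖ ^ 2 := hsums n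
    _ ≤ ∑' i, g i * ‖w i‖ ^ 2 := hw.sum_le_tsum _ fun i _ => mul_nonneg (hg i) (sq_nonneg _)

end Summit.NavierStokesRegularity.FluidComputer.AbcClassIIEigenpair

end
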